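import Literature.AnabelianGeometry.SemiGraphs.TemperedPiSystem
import Literature.AnabelianGeometry.SemiGraphs.UniversalCoveringOverUniversal
import Literature.AnabelianGeometry.SemiGraphs.CoveringComponent
import Literature.AnabelianGeometry.SemiGraphs.SplitsLemmas

/-!
# The action of `Gal(𝒢_{∞,n}/𝒢)` on the fibres of a split covering ([SemiAnbd] Prop. 3.6, p. 38)

Towards the equivalence `B^temp(𝒢) ≅ B^temp(π₁^temp(𝒢))` of [SemiAnbd] Prop. 3.6 (ii): for Galois
level data `D` (levels `S n`, base points `x n ∈ (S n)_{v₀}`, `𝒢_{∞,n} = D.cover n`), a covering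
`T`, a point `t ∈ T_{v₀}` and a level `n` such that `S n` splits the component of `t`, the group
`G_n = Aut(𝒢_{∞,n})` acts on the points of `T_{v₀}` in the component of `t` through the universal
morphism `liftAt : 𝒢_{∞,n} ⟶ T.component t` (`UniversalCoveringOverUniversal.lean`):
`σ · t := liftAt_t (σ⁻¹ · bp_n)`.  This file: the definitions, the canonical isomorphisms between
the component objects of equivalent points, the value `1 · t = t`, and the uniqueness principle.
-/

namespace Literature.AnabelianGeometry.SemiGraphs

namespace ProfiniteSemiGraph

open CategoryTheory

universe u

variable {𝒢 : ProfiniteSemiGraph.{u}}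

section ComponentIso

variable (T : CovObj 𝒢) {p p' : T.Point} (hpp : T.SameComponent p p')

/-- Equivalent points have canonically isomorphic component objects (identity on underlying
points). [cite: MochizukiSemiAnbd2006, Def 3.5(ii) p.37] -/
noncomputable def CovObj.componentIso : T.component p ≅ T.component p' where
  hom :=
    { fV := fun v => ObjectProperty.homMk
        { hom := TypeCat.ofHom fun x : T.CompV p v =>
            (⟨x.1, Relation.EqvGen.trans _ _ _ (Relation.EqvGen.symm _ _ hpp) x.2⟩ : T.CompV p' v)
          comm := fun _ => rfl }
      fE := fun e => ObjectProperty.homMk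
        { hom := TypeCat.ofHom fun y : T.CompE p e =>
            (⟨y.1, Relation.EqvGen.trans _ _ _ (Relation.EqvGen.symm _ _ hpp) y.2⟩ : T.CompE p' e)
          comm := fun _ => rfl }
      comm := fun b v h => by
        apply ObjectProperty.hom_ext; apply Action.Hom.ext; apply ConcreteCategory.hom_ext
        intro y; rfl }
  inv :=
    { fV := fun v => ObjectProperty.homMk
        { hom := TypeCat.ofHom fun x : T.CompV p' v =>
            (⟨x.1, Relation.EqvGen.trans _ _ _ hpp x.2⟩ : T.CompV p v)
          comm := fun _ => rfl }
      fE := fun e => ObjectProperty.homMk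
        { hom := TypeCat.ofHom fun y : T.CompE p' e =>
            (⟨y.1, Relation.EqvGen.trans _ _ _ hpp y.2⟩ : T.CompE p e)
          comm := fun _ => rfl }
      comm := fun b v h => by
        apply ObjectProperty.hom_ext; apply Action.Hom.ext; apply ConcreteCategory.hom_ext
        intro y; rfl }
  hom_inv_id := by
    refine CovHom.ext (funext fun v => ?_) (funext fun e => ?_) <;> rfl
  inv_hom_id := by
    refine CovHom.ext (funext fun v => ?_) (funext fun e => ?_) <;> rfl

/-- The canonical isomorphism commutes with the inclusions. [cite: MochizukiSemiAnbd2006, Def 3.5(ii) p.37] -/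
theorem CovObj.componentIso_hom_ι :
    (T.componentIso hpp).hom ≫ T.componentι p' = T.componentι p := by
  refine CovHom.ext (funext fun v => ?_) (funext fun e => ?_) <;> rfl

/-- Splitting of a component object only depends on the component.
[cite: MochizukiSemiAnbd2006, Def 3.5(ii) p.37] -/
theorem CovObj.splits_component_of_sameComponent (hpp' : T.SameComponent p p') {S : CovObj 𝒢}
    (hs : S.Splits (T.component p)) : S.Splits (T.component p') :=
  CovObj.Splits.of_hom_right (T.componentIso hpp').inv
    (fun v _ _ hab => Subtype.ext
      (congrArg (fun z : T.CompV p v => z.1) hab))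
    (fun e _ _ hab => Subtype.ext
      (congrArg (fun z : T.CompE p e => z.1) hab)) hs

end ComponentIso

namespace GaloisLevelData

variable (D : GaloisLevelData 𝒢) (h𝒢 : 𝒢.IsCountable)

/-- The base point `bp_n = (W n, x n, 𝟙)` of `𝒢_{∞,n}` over `v₀`. [cite: MochizukiSemiAnbd2006, Prop 3.6 p.38] -/
noncomputable def bp (n : ℕ) : (D.S n).FibV (Sum.inl (D.W n)) D.v₀ :=
  ⟨⟨D.W n, rfl⟩, ⟨⟨D.x n, rfl⟩, 𝟙 _⟩⟩

variable (T : CovObj 𝒢) (t : (T.SV D.v₀).obj.V) (n : ℕ)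
  (hs : (D.S n).Splits (T.component (Sum.inl ⟨D.v₀, t⟩)))

/-- The universal morphism `𝒢_{∞,n} ⟶ (component of t)` sending `bp_n ↦ t`.
[cite: MochizukiSemiAnbd2006, Prop 3.6 p.38] -/
noncomputable def liftAt : D.cover h𝒢 n ⟶ T.component (Sum.inl ⟨D.v₀, t⟩) :=
  CovObj.liftHom (D.S n) (T.component (Sum.inl ⟨D.v₀, t⟩)) hs (D.x n)
    (⟨t, CovObj.mem_component_self T t⟩ : T.CompV (Sum.inl ⟨D.v₀, t⟩) D.v₀) h𝒢

/-- `liftAt` sends the base point to `t`. [cite: MochizukiSemiAnbd2006, Prop 3.6 p.38] -/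
theorem liftAt_bp :
    ((D.liftAt h𝒢 T t n hs).fV D.v₀).hom.hom (D.bp n) =
      (⟨t, CovObj.mem_component_self T t⟩ : T.CompV (Sum.inl ⟨D.v₀, t⟩) D.v₀) :=
  CovObj.liftHom_basePt (D.S n) (T.component (Sum.inl ⟨D.v₀, t⟩)) hs (D.x n) _ h𝒢

/-- Uniqueness: a morphism `𝒢_{∞,n} ⟶ X` is determined by the image of `bp_n`.
[cite: MochizukiSemiAnbd2006, Prop 3.6 p.38] -/
theorem hom_ext_bp {X : CovObj 𝒢} (φ ψ : D.cover h𝒢 n ⟶ X)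
    (h : (φ.fV D.v₀).hom.hom (D.bp n) = (ψ.fV D.v₀).hom.hom (D.bp n)) : φ = ψ :=
  (D.S n).univCoverOver_hom_ext _ h𝒢 φ ψ (D.bp n) h

/-- **The action of `G_n = Aut(𝒢_{∞,n})` on the points of `T_{v₀}` whose component is split by
`S n`**: `σ · t := liftAt_t (σ⁻¹ · bp_n)`. [cite: MochizukiSemiAnbd2006, Prop 3.6 p.38] -/
noncomputable def actAt (σ : D.Gal h𝒢 n) : (T.SV D.v₀).obj.V :=
  (((D.liftAt h𝒢 T t n hs).fV D.v₀).hom.hom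
    (((σ⁻¹ : D.Gal h𝒢 n).hom.fV D.v₀).hom.hom (D.bp n))).1

/-- `1 · t = t`. [cite: MochizukiSemiAnbd2006, Prop 3.6 p.38] -/
theorem actAt_one : D.actAt h𝒢 T t n hs 1 = t := by
  change (((D.liftAt h𝒢 T t n hs).fV D.v₀).hom.hom
    ((((1 : D.Gal h𝒢 n)⁻¹).hom.fV D.v₀).hom.hom (D.bp n))).1 = t
  rw [inv_one]
  change (((D.liftAt h𝒢 T t n hs).fV D.v₀).hom.hom (D.bp n)).1 = t
  rw [D.liftAt_bp h𝒢 T t n hs]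

/-- The acted point stays in the component of `t`. [cite: MochizukiSemiAnbd2006, Prop 3.6 p.38] -/
theorem sameComponent_actAt (σ : D.Gal h𝒢 n) :
    T.SameComponent (Sum.inl ⟨D.v₀, t⟩) (Sum.inl ⟨D.v₀, D.actAt h𝒢 T t n hs σ⟩) :=
  (((D.liftAt h𝒢 T t n hs).fV D.v₀).hom.hom
    (((σ⁻¹ : D.Gal h𝒢 n).hom.fV D.v₀).hom.hom (D.bp n))).2

/-- The stabiliser contains the kernel of the action on `𝒢_{∞,n}`... in fact every `σ` fixing
`bp_n`: if `σ⁻¹ · bp_n = bp_n` then `σ · t = t`. [cite: MochizukiSemiAnbd2006, Prop 3.6 p.38] -/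
theorem actAt_eq_self_of_fix (σ : D.Gal h𝒢 n)
    (hσ : ((σ⁻¹ : D.Gal h𝒢 n).hom.fV D.v₀).hom.hom (D.bp n) = D.bp n) :
    D.actAt h𝒢 T t n hs σ = t := by
  change (((D.liftAt h𝒢 T t n hs).fV D.v₀).hom.hom
    (((σ⁻¹ : D.Gal h𝒢 n).hom.fV D.v₀).hom.hom (D.bp n))).1 = t
  rw [hσ, D.liftAt_bp h𝒢 T t n hs]

/-- Splitting hypothesis for the acted point. [cite: MochizukiSemiAnbd2006, Prop 3.6 p.38] -/
theorem splits_actAt (σ : D.Gal h𝒢 n) :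
    (D.S n).Splits (T.component (Sum.inl ⟨D.v₀, D.actAt h𝒢 T t n hs σ⟩)) :=
  T.splits_component_of_sameComponent (D.sameComponent_actAt h𝒢 T t n hs σ) hs

/-- The universal morphism at the acted point `τ · t` is the `τ⁻¹`-translate of the one at `t`
(followed by the canonical identification of the component objects).
[cite: MochizukiSemiAnbd2006, Prop 3.6 p.38] -/
theorem liftAt_actAt (τ : D.Gal h𝒢 n)
    (hs' : (D.S n).Splits (T.component (Sum.inl ⟨D.v₀, D.actAt h𝒢 T t n hs τ⟩))) :
    D.liftAt h𝒢 T (D.actAt h𝒢 T t n hs τ) n hs' =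
      (τ⁻¹ : D.Gal h𝒢 n).hom ≫ D.liftAt h𝒢 T t n hs ≫
        (T.componentIso (D.sameComponent_actAt h𝒢 T t n hs τ)).hom := by
  apply D.hom_ext_bp h𝒢 n
  rw [D.liftAt_bp]
  apply Subtype.ext
  rfl

/-- **The action is multiplicative**: `(σ τ) · t = σ · (τ · t)`. [cite: MochizukiSemiAnbd2006, Prop 3.6 p.38] -/
theorem actAt_mul (σ τ : D.Gal h𝒢 n)
    (hs' : (D.S n).Splits (T.component (Sum.inl ⟨D.v₀, D.actAt h𝒢 T t n hs τ⟩))) :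
    D.actAt h𝒢 T t n hs (σ * τ) = D.actAt h𝒢 T (D.actAt h𝒢 T t n hs τ) n hs' σ := by
  change (((D.liftAt h𝒢 T t n hs).fV D.v₀).hom.hom
      ((((σ * τ)⁻¹ : D.Gal h𝒢 n).hom.fV D.v₀).hom.hom (D.bp n))).1 =
    (((D.liftAt h𝒢 T (D.actAt h𝒢 T t n hs τ) n hs').fV D.v₀).hom.hom
      (((σ⁻¹ : D.Gal h𝒢 n).hom.fV D.v₀).hom.hom (D.bp n))).1
  rw [D.liftAt_actAt h𝒢 T t n hs τ hs', mul_inv_rev]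
  rfl

/-- The action does not depend on the proof of the splitting hypothesis (proof irrelevance, for
rewriting convenience). [cite: MochizukiSemiAnbd2006, Prop 3.6 p.38] -/
theorem actAt_congr {t t' : (T.SV D.v₀).obj.V} (e : t = t')
    (hs : (D.S n).Splits (T.component (Sum.inl ⟨D.v₀, t⟩)))
    (hs' : (D.S n).Splits (T.component (Sum.inl ⟨D.v₀, t'⟩))) (σ : D.Gal h𝒢 n) :
    D.actAt h𝒢 T t n hs σ = D.actAt h𝒢 T t' n hs' σ := by
  subst e
  rfl

end GaloisLevelData

end ProfiniteSemiGraph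

end Literature.AnabelianGeometry.SemiGraphs
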